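import Summits.AtomisticToContinuum.HydrodynamicLimit.Theorems.JParityClosureCollisionTightnessDomination
import Summits.AtomisticToContinuum.HydrodynamicLimit.Theorems.JParityClosureCollisionTightnessTorusGibbs
import Summits.AtomisticToContinuum.HydrodynamicLimit.Theorems.LocalSecondLaw.Negative.FreeVolume
import Literature.MathematicalPhysics.KineticTheory.HardSphereEulerProofs
import HarnessLib

/-!
# `SuperextensiveClosureCost.TransferInequality` (stmt-AtomisticToContinuum-9512), tools:
# Cauchy–Schwarz, Gaussian domination of `f²/g`, and the free-volume partition-function bound

Helper file (`--supports stmt-AtomisticToContinuum-9512`) for the support item `TransferInequality`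
of the route `SuperextensiveClosureCost` of the sub-problem `HydrodynamicLimit` (the static `L²`
transfer budget `LG(S)² ≤ e^{C(N+1)} · G(S)` between the local Gibbs law
`LG = localGibbsLaw σ a₀ u₀ θ₀ N Φ` and the homogeneous Gibbs law `G = localGibbsLaw σ 1 0 θe N Φ`,
`θ₀ < 2θe`). The three analytic inputs of the Cauchy–Schwarz argument:

* `lintegral_sq_le_lintegral_sq_mul_measure_univ` — Cauchy–Schwarz against `1` for `∫⁻`:
  `(∫⁻ f dμ)² ≤ (∫⁻ f² dμ) μ(univ)` (Hölder `(2,2)`, `ENNReal.lintegral_mul_le_Lp_mul_Lq`).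
* `exists_sq_div_le_localMaxwellian`, `lintegral_sq_div_le` — the one-body density ratio is square
  integrable uniformly in the position: for bounded continuous profiles with `sup θ₀ = Θ < 2θe`,
  `f(x,v)²/g(x,v) ≤ K · M_{1,u₀(x),θ'}(v)` with `θ' = 2θeΘ/(2θe − Θ)` (complete the square,
  `exponent_bound`), hence `∫∫ f²/g dv dx ≤ K`. This is exactly where `θ₀ < 2θe` enters.
* `pow_le_posPartition` — the free-volume lower bound on the configurational partition function at
  fixed reduced density `0 < σ < 1/2`: `Z_pos(a₀, ε_N, N+1) ≥ (a (1 − 4πσ³/3))^{N+1}` for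
  `a ≤ a₀`, `ε_N = σ (N+1)^{-1/3}`, by sequential insertion
  (`LocalSecondLawNegative.volume_sepSet_ge`: the `(N+1)`-st sphere avoids `N` balls of volume
  `(4π/3)ε_N³ = (4π/3)σ³/(N+1)` each); and `posPartition_one_le_one` (`Z_pos(1) ≤ 1`).

References: C. Kipnis, C. Landim, *Scaling Limits of Interacting Particle Systems* (1999), App. 1 §8
(entropy and `L²` bounds between a local equilibrium and the invariant state); H. Spohn, *Large Scale
Dynamics of Interacting Particles* (1991), Part I §2.3; D. Ruelle, *Statistical Mechanics* (1969),
§3.4 (free volume of hard spheres).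
-/

noncomputable section

open MeasureTheory Set Filter Topology
open scoped ENNReal

namespace Summit.AtomisticToContinuum.HydrodynamicLimit.Theorems

namespace TransferBudget

open Literature.Analysis.FluidPDE Literature.MathematicalPhysics.KineticTheory

/-! ### Cauchy–Schwarz in `L²(μ)` against the constant `1` -/

/-- Cauchy–Schwarz against `1` for the lower Lebesgue integral:
`(∫⁻ f dμ)² ≤ (∫⁻ f² dμ) · μ(univ)`. [folklore] -/
theorem lintegral_sq_le_lintegral_sq_mul_measure_univ {α : Type*} [MeasurableSpace α]
    (μ : Measure α) {f : α → ℝ≥0∞} (hf : AEMeasurable f μ) :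
    (∫⁻ x, f x ∂μ) ^ 2 ≤ (∫⁻ x, f x ^ 2 ∂μ) * μ univ := by
  have h := ENNReal.lintegral_mul_le_Lp_mul_Lq μ Real.HolderConjugate.two_two hf
    (g := fun _ => (1 : ℝ≥0∞)) aemeasurable_const
  simp only [Pi.mul_apply, mul_one, ENNReal.one_rpow, lintegral_const, one_mul] at h
  have h2 : ∀ x : ℝ≥0∞, (x ^ (1 / (2 : ℝ))) ^ 2 = x := fun x => by
    rw [← ENNReal.rpow_natCast, ← ENNReal.rpow_mul]
    norm_num
  calc (∫⁻ x, f x ∂μ) ^ 2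
      ≤ ((∫⁻ x, f x ^ (2 : ℝ) ∂μ) ^ (1 / (2 : ℝ)) * (μ univ) ^ (1 / (2 : ℝ))) ^ 2 := by
        gcongr
    _ = (∫⁻ x, f x ^ 2 ∂μ) * μ univ := by
        rw [mul_pow, h2, h2]
        simp_rw [ENNReal.rpow_two]

/-! ### Gaussian domination of `f²/g` -/

/-- The square-completion inequality behind the `L²` budget: for `0 < Θ < 2 θe`, `s, r ≥ 0`,
`-s²/Θ + (s + r)²/(2θe) ≤ (1 + 2Θ/(2θe − Θ)) r²/(2θe) − (2θe − Θ) s²/(4 θe Θ)`. [folklore] -/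
theorem exponent_bound {Θ θe s r : ℝ} (hΘ : 0 < Θ) (hθe : 0 < θe) (hlt : Θ < 2 * θe) :
    -s ^ 2 / Θ + (s + r) ^ 2 / (2 * θe) ≤
      (1 + 2 * Θ / (2 * θe - Θ)) * r ^ 2 / (2 * θe) - (2 * θe - Θ) / (4 * θe * Θ) * s ^ 2 := by
  set δ := 2 * θe - Θ with hδ
  have hδ0 : 0 < δ := by rw [hδ]; linarith
  have key : -s ^ 2 / Θ + (s + r) ^ 2 / (2 * θe) -
      ((1 + 2 * Θ / δ) * r ^ 2 / (2 * θe) - δ / (4 * θe * Θ) * s ^ 2) =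
      -(δ / (4 * θe * Θ)) * (s - 2 * Θ * r / δ) ^ 2 := by
    rw [hδ] at *
    field_simp
    ring
  have hsq : 0 ≤ (δ / (4 * θe * Θ)) * (s - 2 * Θ * r / δ) ^ 2 := by positivity
  linarith [key, hsq]

variable {a₀ θ₀ : T3 → ℝ} {u₀ : T3 → V3}

/-- **Gaussian domination of `f²/g`.** If `0 ≤ a₀ ≤ A`, `0 < ϑ ≤ θ₀ ≤ Θ`, `‖u₀‖ ≤ U` and
`Θ < 2θe`, then the square of the one-body local Gibbs profile `f = a₀(x) M_{1,u₀(x),θ₀(x)}`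
divided by the homogeneous profile `g = M_{1,0,θe}` is dominated, uniformly in `x`, by a multiple
of a local Maxwellian: `f(x,v)²/g(x,v) ≤ K · M_{1,u₀(x),θ'}(v)` with `θ' = 2θeΘ/(2θe − Θ)`
(complete the square, `exponent_bound`). This is the square-integrability of the density ratio
`dLG/dG` in `L²(G)` behind the hypothesis `θ₀ < 2θe`. [folklore] -/
theorem exists_sq_div_le_localMaxwellian {A Θ ϑ U θe : ℝ} (ha0 : ∀ x, 0 ≤ a₀ x)
    (hA : ∀ x, a₀ x ≤ A) (hϑ0 : 0 < ϑ) (hϑ : ∀ x, ϑ ≤ θ₀ x) (hΘ : ∀ x, θ₀ x ≤ Θ)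
    (hU : ∀ x, ‖u₀ x‖ ≤ U) (hθe : 0 < θe) (hlt : Θ < 2 * θe) :
    ∃ K θ' : ℝ, 0 ≤ K ∧ 0 < θ' ∧ ∀ (x : T3) (v : V3),
      localGibbsProfile a₀ u₀ θ₀ (x, v) ^ 2 /
          localGibbsProfile (fun _ => 1) (fun _ => (0 : V3)) (fun _ => θe) (x, v) ≤
        K * localMaxwellian 1 θ' (u₀ x) v := by
  have hΘ0 : 0 < Θ := hϑ0.trans_le ((hϑ 0).trans (hΘ 0))
  have hA0 : 0 ≤ A := (ha0 0).trans (hA 0)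
  set δ : ℝ := 2 * θe - Θ with hδ
  have hδ0 : 0 < δ := by rw [hδ]; linarith
  set θ' : ℝ := 2 * θe * Θ / δ with hθ'
  have hθ'0 : 0 < θ' := by positivity
  set d : ℝ := (Module.finrank ℝ V3 : ℝ) with hd
  have hd0 : 0 ≤ d := by rw [hd]; exact_mod_cast Nat.zero_le _
  set c₁ : ℝ := (2 * Real.pi * ϑ) ^ (-d / 2) with hc₁
  set pe : ℝ := (2 * Real.pi * θe) ^ (-d / 2) with hpe
  set p' : ℝ := (2 * Real.pi * θ') ^ (-d / 2) with hp'
  have hc₁0 : 0 < c₁ := Real.rpow_pos_of_pos (by positivity) _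
  have hpe0 : 0 < pe := Real.rpow_pos_of_pos (by positivity) _
  have hp'0 : 0 < p' := Real.rpow_pos_of_pos (by positivity) _
  set C₀ : ℝ := (1 + 2 * Θ / δ) * U ^ 2 / (2 * θe) with hC₀
  refine ⟨A ^ 2 * c₁ ^ 2 * Real.exp C₀ / (pe * p'), θ', by positivity, hθ'0, fun x v => ?_⟩
  have hθx : 0 < θ₀ x := hϑ0.trans_le (hϑ x)
  set s : ℝ := ‖v - u₀ x‖ with hs
  set r : ℝ := ‖u₀ x‖ with hr
  have hs0 : 0 ≤ s := norm_nonneg _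
  have hr0 : 0 ≤ r := norm_nonneg _
  -- the three profiles, unfolded
  set p₀ : ℝ := (2 * Real.pi * θ₀ x) ^ (-d / 2) with hp₀
  have hp₀0 : 0 < p₀ := Real.rpow_pos_of_pos (by positivity) _
  set e₁ : ℝ := Real.exp (-s ^ 2 / (2 * θ₀ x)) with he₁
  set e₂ : ℝ := Real.exp (-‖v‖ ^ 2 / (2 * θe)) with he₂
  set e' : ℝ := Real.exp (-s ^ 2 / (2 * θ')) with he'
  have hf : localGibbsProfile a₀ u₀ θ₀ (x, v) = a₀ x * (p₀ * e₁) := by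
    simp only [localGibbsProfile, localMaxwellian, one_mul, hp₀, he₁, hs]
    rfl
  have hg : localGibbsProfile (fun _ => 1) (fun _ => (0 : V3)) (fun _ => θe) (x, v) = pe * e₂ := by
    simp only [localGibbsProfile, localMaxwellian, one_mul, hpe, he₂, sub_zero]
    rfl
  have hM : localMaxwellian 1 θ' (u₀ x) v = p' * e' := by
    simp only [localMaxwellian, one_mul, hp', he', hs]
    rfl
  have hgpos : 0 < pe * e₂ := mul_pos hpe0 (Real.exp_pos _)
  -- factor bounds
  have h1 : a₀ x ^ 2 ≤ A ^ 2 := pow_le_pow_left₀ (ha0 x) (hA x) 2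
  have h2 : p₀ ^ 2 ≤ c₁ ^ 2 := by
    have hpre : p₀ ≤ c₁ :=
      Real.rpow_le_rpow_of_nonpos (by positivity) (by nlinarith [hϑ x, Real.pi_pos]) (by linarith)
    exact pow_le_pow_left₀ hp₀0.le hpre 2
  have h3 : e₁ ^ 2 ≤ Real.exp C₀ * e' * e₂ := by
    have hquot : e₁ ^ 2 / e₂ = Real.exp (-s ^ 2 / θ₀ x + ‖v‖ ^ 2 / (2 * θe)) := by
      rw [he₁, he₂, sq, ← Real.exp_add, ← Real.exp_sub]
      congr 1
      field_simp
      ring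
    have hexp : -s ^ 2 / θ₀ x + ‖v‖ ^ 2 / (2 * θe) ≤ C₀ + -s ^ 2 / (2 * θ') := by
      have hv : ‖v‖ ≤ s + r := by
        calc ‖v‖ = ‖(v - u₀ x) + u₀ x‖ := by rw [sub_add_cancel]
          _ ≤ ‖v - u₀ x‖ + ‖u₀ x‖ := norm_add_le _ _
      have hv2 : ‖v‖ ^ 2 ≤ (s + r) ^ 2 := pow_le_pow_left₀ (norm_nonneg v) hv 2
      have ha : -s ^ 2 / θ₀ x ≤ -s ^ 2 / Θ := by
        rw [neg_div, neg_div, neg_le_neg_iff]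
        exact div_le_div_of_nonneg_left (sq_nonneg _) hθx (hΘ x)
      have hb : ‖v‖ ^ 2 / (2 * θe) ≤ (s + r) ^ 2 / (2 * θe) :=
        div_le_div_of_nonneg_right hv2 (by positivity)
      have hc := exponent_bound (s := s) (r := r) hΘ0 hθe hlt
      have hr2 : r ^ 2 ≤ U ^ 2 := pow_le_pow_left₀ hr0 (hU x) 2
      have hdd : (1 + 2 * Θ / (2 * θe - Θ)) * r ^ 2 / (2 * θe) ≤ C₀ := by
        rw [hC₀]
        refine div_le_div_of_nonneg_right ?_ (by positivity)
        exact mul_le_mul_of_nonneg_left hr2 (by positivity)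
      have hee : -((2 * θe - Θ) / (4 * θe * Θ) * s ^ 2) = -s ^ 2 / (2 * θ') := by
        rw [hθ']
        field_simp
        ring
      linarith
    rw [← div_le_iff₀ (Real.exp_pos _), hquot, he', ← Real.exp_add]
    exact Real.exp_le_exp.2 hexp
  -- assembly
  rw [hf, hg, hM, div_le_iff₀ hgpos]
  calc (a₀ x * (p₀ * e₁)) ^ 2 = a₀ x ^ 2 * p₀ ^ 2 * e₁ ^ 2 := by ring
    _ ≤ A ^ 2 * c₁ ^ 2 * (Real.exp C₀ * e' * e₂) := by gcongr
    _ = A ^ 2 * c₁ ^ 2 * Real.exp C₀ / (pe * p') * (p' * e') * (pe * e₂) := by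
        field_simp

/-- **The one-body `L²` integral is finite, uniformly in the position**: under the Gaussian
domination `f²/g ≤ K · M_{1,u₀(x),θ'}`, `∫∫ f(x,v)²/g(x,v) dv dx ≤ K` (the local Maxwellian has unit
mass and `𝕋³` unit volume). [folklore] -/
theorem lintegral_sq_div_le (hu : Continuous u₀) {θe K θ' : ℝ} (hK : 0 ≤ K) (hθ' : 0 < θ')
    (hdom : ∀ (x : T3) (v : V3),
      localGibbsProfile a₀ u₀ θ₀ (x, v) ^ 2 /
          localGibbsProfile (fun _ => 1) (fun _ => (0 : V3)) (fun _ => θe) (x, v) ≤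
        K * localMaxwellian 1 θ' (u₀ x) v) :
    ∫⁻ y : T3 × V3, ENNReal.ofReal (localGibbsProfile a₀ u₀ θ₀ y ^ 2 /
        localGibbsProfile (fun _ => 1) (fun _ => (0 : V3)) (fun _ => θe) y) ≤ ENNReal.ofReal K := by
  have hMm : Measurable fun y : T3 × V3 =>
      ENNReal.ofReal (K * localMaxwellian 1 θ' (u₀ y.1) y.2) := by
    refine ENNReal.measurable_ofReal.comp (measurable_const.mul ?_)
    unfold localMaxwellian
    fun_prop
  calc ∫⁻ y : T3 × V3, ENNReal.ofReal (localGibbsProfile a₀ u₀ θ₀ y ^ 2 /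
          localGibbsProfile (fun _ => 1) (fun _ => (0 : V3)) (fun _ => θe) y)
      ≤ ∫⁻ y : T3 × V3, ENNReal.ofReal (K * localMaxwellian 1 θ' (u₀ y.1) y.2) :=
        lintegral_mono fun y => ENNReal.ofReal_le_ofReal (hdom y.1 y.2)
    _ = ∫⁻ x : T3, ∫⁻ v : V3, ENNReal.ofReal (K * localMaxwellian 1 θ' (u₀ x) v) :=
        lintegral_prod _ hMm.aemeasurable
    _ = ∫⁻ _x : T3, ENNReal.ofReal K := by
        refine lintegral_congr fun x => ?_
        simp_rw [ENNReal.ofReal_mul hK]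
        rw [lintegral_const_mul' _ _ ENNReal.ofReal_ne_top,
          ← ofReal_integral_eq_lintegral_ofReal (integrable_localMaxwellian hθ' _)
            (ae_of_all _ fun v => localMaxwellian_nonneg zero_le_one hθ'.le _ _),
          integral_localMaxwellian_one hθ' _, ENNReal.ofReal_one, mul_one]
    _ = ENNReal.ofReal K := by rw [lintegral_const, measure_univ, mul_one]

/-! ### Partition functions -/

/-- The homogeneous configurational partition function is at most `1` (unit torus volume).
[folklore] -/
theorem posPartition_one_le_one (ε : ℝ) (n : ℕ) : posPartition (fun _ => (1 : ℝ)) ε n ≤ 1 := by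
  unfold posPartition
  calc ∫ x, posWeight (fun _ => (1 : ℝ)) ε n x ≤ ∫ _x : Fin n → T3, (1 : ℝ) :=
        integral_mono (integrable_posWeight continuous_const (fun _ => zero_le_one) ε n)
          (integrable_const 1) fun x =>
            (posWeight_le_pow (fun _ => zero_le_one) (fun _ => le_rfl) ε x).trans (by simp)
    _ = 1 := by simp

/-- **Free-volume lower bound for the configurational partition function at fixed reduced
density**: for `0 < σ < 1/2` and `0 ≤ a ≤ a₀`,
`(a (1 − 4πσ³/3))^{N+1} ≤ Z_pos(a₀, ε_N, N+1)`, `ε_N = σ(N+1)^{-1/3}` (sequential insertion,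
`volume_sepSet_ge`: each of the `N + 1` spheres avoids at most `N + 1` balls of volume
`(4π/3)ε_N³ = (4π/3)σ³/(N+1)`). [folklore] -/
theorem pow_le_posPartition (ha : Continuous a₀) {a : ℝ} (ha_nn : 0 ≤ a) (haa : ∀ x, a ≤ a₀ x)
    {σ : ℝ} (hσ0 : 0 < σ) (hσ : σ < 1 / 2) (N : ℕ) :
    (a * (1 - 4 * Real.pi / 3 * σ ^ 3)) ^ (N + 1) ≤ posPartition a₀ (hsDiameter σ N) (N + 1) := by
  set ε := hsDiameter σ N with hε
  have hN0 : (0 : ℝ) < ((N + 1 : ℕ) : ℝ) := by positivity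
  have hε0 : 0 ≤ ε := by
    rw [hε, hsDiameter]
    exact mul_nonneg hσ0.le (Real.rpow_nonneg hN0.le _)
  have hε3 : ((N + 1 : ℕ) : ℝ) * ε ^ 3 = σ ^ 3 := by
    rw [hε, hsDiameter, mul_pow, ← Real.rpow_mul_natCast hN0.le]
    norm_num
    rw [Real.rpow_neg_one]
    field_simp
  have hεσ : ε ≤ σ := by
    rw [hε, hsDiameter]
    have h1 : ((N + 1 : ℕ) : ℝ) ^ (-(1 / 3 : ℝ)) ≤ 1 :=
      Real.rpow_le_one_of_one_le_of_nonpos (by exact_mod_cast Nat.succ_le_succ (Nat.zero_le N))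
        (by norm_num)
    calc σ * ((N + 1 : ℕ) : ℝ) ^ (-(1 / 3 : ℝ)) ≤ σ * 1 :=
          mul_le_mul_of_nonneg_left h1 hσ0.le
      _ = σ := mul_one σ
  have hε2 : ε < 1 / 2 := hεσ.trans_lt hσ
  have hm : ((N + 1 : ℕ) : ℝ) * (4 * Real.pi / 3 * ε ^ 3) = 4 * Real.pi / 3 * σ ^ 3 := by
    rw [← hε3]; ring
  have hpi := Real.pi_le_four
  have hσ3 : σ ^ 3 < 1 / 8 := by
    have := pow_lt_pow_left₀ hσ hσ0.le (three_ne_zero)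
    norm_num at this
    exact this
  have hq1 : 4 * Real.pi / 3 * σ ^ 3 ≤ 1 := by nlinarith [pow_pos hσ0 3]
  have hmle : ((N + 1 : ℕ) : ℝ) * (4 * Real.pi / 3 * ε ^ 3) ≤ 1 := by rw [hm]; exact hq1
  -- free volume
  have hvol := LocalSecondLawNegative.volume_sepSet_ge hε0 hε2 hmle (N + 1) le_rfl
  rw [hm] at hvol
  have hsub : LocalSecondLawNegative.sepSet (N + 1) ε ⊆ posDomain ε (N + 1) :=
    fun q hq i j hij => (hq i j hij).le
  have hq0 : 0 ≤ 1 - 4 * Real.pi / 3 * σ ^ 3 := by linarith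
  have hvol' : (1 - 4 * Real.pi / 3 * σ ^ 3) ^ (N + 1) ≤ (volume (posDomain ε (N + 1))).toReal := by
    have h1 := (ENNReal.ofReal_le_iff_le_toReal (measure_ne_top _ _)).1 hvol
    exact h1.trans (ENNReal.toReal_mono (measure_ne_top _ _) (measure_mono hsub))
  have hone : posPartition (fun _ => (1 : ℝ)) ε (N + 1) = (volume (posDomain ε (N + 1))).toReal := by
    rw [posPartition_const, one_pow, one_mul]
  calc (a * (1 - 4 * Real.pi / 3 * σ ^ 3)) ^ (N + 1)
      = a ^ (N + 1) * (1 - 4 * Real.pi / 3 * σ ^ 3) ^ (N + 1) := mul_pow _ _ _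
    _ ≤ a ^ (N + 1) * posPartition (fun _ => (1 : ℝ)) ε (N + 1) := by
        rw [hone]
        exact mul_le_mul_of_nonneg_left hvol' (pow_nonneg ha_nn _)
    _ ≤ posPartition a₀ ε (N + 1) := const_pow_mul_posPartition_one_le ha ha_nn haa ε (N + 1)

/-! ### The `L²` budget -/

/-- `x ^ n ≤ exp (x n)` for `0 ≤ x`. [folklore] -/
theorem pow_le_exp_mul {x : ℝ} (hx : 0 ≤ x) (n : ℕ) : x ^ n ≤ Real.exp (x * n) := by
  calc x ^ n ≤ Real.exp x ^ n :=
        pow_le_pow_left₀ hx (by linarith [Real.add_one_le_exp x]) n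
    _ = Real.exp (x * n) := by rw [← Real.exp_nat_mul]; ring_nf

end TransferBudget

end Summit.AtomisticToContinuum.HydrodynamicLimit.Theorems

end
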